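import Summits.AtomisticToContinuum.BoseEinsteinCondensation.Theorems.BECCutLineWeakDisorderDefs
import HarnessLib

/-!
# Route `BECCutLineWeakDisorder`, crux `TwoReplicaTransienceBound` (stmt-AtomisticToContinuum-9687):
# line `SketchIdeator1` (tracer decoupling) — stub statements v3 (time-nonnegativity repair)

Continuation of the (full, 398-line) route Defs file `BECCutLineWeakDisorderDefs.lean`. NOTHING IS
ASSERTED: one statement and two audit aliases, plus the sorry-free composition.

Repair (lead, cycle 1, second reshape). The v2 decoupling statement `ProfileDecoupling` is misstated
for NEGATIVE times: for `T < 0` the killing window `[0, T]` is empty, so `fkWeight ≡ 1`,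
`fkPartition ≡ 1`, `tracer ≡ 1` on all of `ℝ³`, its left side is `∫ 1 dx = ∞` while its right side is
`∞ · ∫ (∞/∞) dW_n = ∞ · 0 = 0` (`[0,∞]` conventions). The composition only ever uses `T ≥ 1`, so the
repair is the same statement under `0 ≤ T` (`TiltedDecoupling`; for `T ≥ 0` the tracer functional
vanishes outside the box `Λ_L`, so `∫ₓ tracer ≤ |Λ_L| < ∞` and no `∞/∞` occurs), composed exactly as
before (`stub_tiltedCompose`, proved below from `sq_div_sq_le_mul_div` and the normalisation
bookkeeping of `stub_profileCompose`).
-/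

noncomputable section

namespace Summit.AtomisticToContinuum.BoseEinsteinCondensation.Cruxes.TwoReplicaTransienceBound.TracerDecoupling

open MeasureTheory Filter Set
open scoped ENNReal NNReal Topology BigOperators
open Literature.MathematicalPhysics.QuantumManyBody.BoseGas

variable {n : ℕ}

/-- STUB `stub_tiltedDecoupling` — **profile (tilted) decoupling, nonnegative times**: for measurable
`v`, `0 ≤ T`, given the factorisation of `Z_T(·::Y)` through the tracer and the joint measurability of
the tracer functional,
`∫ₓ Z(x::Y)² ≤ s(Y) · ∫ w(Y,ωb) · (∫ₓ g(x,ωb)² / ∫ₓ g(x,ωb)) dW_n(ωb)`, `s(Y) = ∫ₓ Z(x::Y)`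
(Cauchy–Schwarz pointwise in `x` with the weights `w(ωb)·∫ₓg(·,ωb)` on `{0 < ∫ₓ g < ∞}` — for `T ≥ 0`
the tracer vanishes off `Λ_L`, so `∫ₓ g ≤ |Λ_L|`; bath paths with `∫ₓ g = 0` contribute nothing; Tonelli). -/
def TiltedDecoupling : Prop :=
  ∀ (n : ℕ) (v : ℝ → ℝ≥0∞), Measurable v → ∀ (L T : ℝ) (Y : Config n), 0 ≤ T →
    (∀ x : Space, fkPartition v L T (Matrix.vecCons x Y) =
      ∫⁻ ωb, fkWeight v L T Y ωb * tracer v L T x Y ωb ∂wienerPaths n) →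
    (Measurable fun p : Space × PathSpace n => tracer v L T p.1 Y p.2) →
    ∫⁻ x, fkPartition v L T (Matrix.vecCons x Y) ^ 2 ≤
      (∫⁻ x, fkPartition v L T (Matrix.vecCons x Y)) *
        ∫⁻ ωb, fkWeight v L T Y ωb *
          ((∫⁻ x, tracer v L T x Y ωb ^ 2) / ∫⁻ x, tracer v L T x Y ωb) ∂wienerPaths n

namespace Goal

/-- Registered stub `stub_tiltedDecoupling`. -/
abbrev stub_tiltedDecoupling : Prop := TiltedDecoupling

/-- Registered bookkeeping stub `stub_tiltedCompose` (proved below): the v3 line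
`stub_factorisation → stub_tracerMeasurable → stub_tiltedDecoupling → stub_tracerProfileBound ⇒ crux`. -/
abbrev stub_tiltedCompose : Prop :=
  stub_factorisation → stub_tracerMeasurable → stub_tiltedDecoupling → stub_tracerProfileBound →
    Summit.AtomisticToContinuum.BoseEinsteinCondensation.Theses.BECCutLineWeakDisorder.TwoReplicaTransienceBound

end Goal

/-- **Composition of the v3 line** (`stub_tiltedCompose`, sorry-free): the normalisation
bookkeeping of `stub_profileCompose` with `TiltedDecoupling` used at the times `T ≥ 1 ≥ 0` of the
crux. -/
theorem stub_tiltedCompose : Goal.stub_tiltedCompose := by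
  intro hF hM hD hE v hv
  obtain ⟨ρ₀, hρ₀, H⟩ := hE v hv
  refine ⟨ρ₀, hρ₀, fun ρ hρ hρlt => ?_⟩
  obtain ⟨C, hC, hev⟩ := H ρ hρ hρlt
  refine ⟨C, hC, ?_⟩
  filter_upwards [hev] with n hn T hT
  have hvm : Measurable v := hv.1
  have hT0 : (0 : ℝ) ≤ T := zero_le_one.trans hT
  set L : ℝ := sideLength ρ (n + 1) with hL
  set 𝒩 : ℝ≥0∞ := fkNormSq (N := n + 1) v L T (fun _ => (1 : ℝ≥0∞)) with h𝒩
  set c : ℝ := (Real.sqrt 𝒩.toReal)⁻¹ with hc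
  have hΨ : ∀ X, fkWitness (N := n + 1) v L T (fun _ => (1 : ℝ≥0∞)) X =
      c * (fkPartition v L T X).toReal := fun X => fkWitness_one_eq v L T X
  by_cases hc0 : c = 0
  · have h0 : ∀ X, fkWitness (N := n + 1) v L T (fun _ => (1 : ℝ≥0∞)) X = 0 := fun X => by
      rw [hΨ X, hc0, zero_mul]
    simp [h0]
  have hsqrt : Real.sqrt 𝒩.toReal ≠ 0 := fun h => hc0 (by rw [hc, h, inv_zero])
  have htR : 0 < 𝒩.toReal := not_le.1 fun h => hsqrt (Real.sqrt_eq_zero'.2 h)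
  have h𝒩0 : 𝒩 ≠ 0 := fun h => htR.ne' (by rw [h, ENNReal.toReal_zero])
  have h𝒩top : 𝒩 ≠ ⊤ := fun h => htR.ne' (by rw [h, ENNReal.toReal_top])
  have hc𝒩 : ENNReal.ofReal (c ^ 2) * 𝒩 = 1 := by
    have hc2 : c ^ 2 = (𝒩.toReal)⁻¹ := by rw [hc, inv_pow, Real.sq_sqrt htR.le]
    rw [hc2, ENNReal.ofReal_inv_of_pos htR, ENNReal.ofReal_toReal h𝒩top,
      ENNReal.inv_mul_cancel h𝒩0 h𝒩top]
  have hnn : ∀ X : Config (n + 1), (‖(fkPartition v L T X).toReal‖₊ : ℝ≥0∞) = fkPartition v L T X :=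
    fun X => coe_nnnorm_toReal (fkPartition_ne_top v L T X)
  have hmono : ∫⁻ Y : Config n, ENNReal.ofReal (L ^ 3) *
        (∫⁻ x, fkPartition v L T (Matrix.vecCons x Y) ^ 2) ^ 2 /
          (∫⁻ x, fkPartition v L T (Matrix.vecCons x Y)) ^ 2 ≤
      ∫⁻ Y : Config n, ENNReal.ofReal (L ^ 3) *
        ((∫⁻ x, fkPartition v L T (Matrix.vecCons x Y) ^ 2) *
          ∫⁻ ωb, fkWeight v L T Y ωb *
            ((∫⁻ x, tracer v L T x Y ωb ^ 2) / ∫⁻ x, tracer v L T x Y ωb) ∂wienerPaths n) /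
          (∫⁻ x, fkPartition v L T (Matrix.vecCons x Y)) := by
    refine lintegral_mono fun Y => ?_
    rw [mul_div_assoc, mul_div_assoc]
    exact mul_le_mul' le_rfl (sq_div_sq_le_mul_div
      (hD n v hvm L T Y hT0 (fun x => hF n v hvm L T x Y) (hM n v hvm L T Y)))
  simp_rw [hΨ]
  rw [Theorems.CutLineWitness.lintegral_ratio_const_mul L (fun X => (fkPartition v L T X).toReal) hc0]
  simp_rw [hnn]
  calc ENNReal.ofReal (c ^ 2) * ∫⁻ Y : Config n, ENNReal.ofReal (L ^ 3) *
        (∫⁻ x, fkPartition v L T (Matrix.vecCons x Y) ^ 2) ^ 2 /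
          (∫⁻ x, fkPartition v L T (Matrix.vecCons x Y)) ^ 2
      ≤ ENNReal.ofReal (c ^ 2) * (ENNReal.ofReal C * 𝒩) :=
        mul_le_mul' le_rfl (hmono.trans (hn T hT))
    _ = ENNReal.ofReal C * (ENNReal.ofReal (c ^ 2) * 𝒩) := by ring
    _ = ENNReal.ofReal C := by rw [hc𝒩, mul_one]

end Summit.AtomisticToContinuum.BoseEinsteinCondensation.Cruxes.TwoReplicaTransienceBound.TracerDecoupling

end
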